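import Mathlib.Analysis.SpecialFunctions.Integrals.Basic
import Mathlib.Analysis.SpecialFunctions.SmoothTransition
import Mathlib.Analysis.SpecialFunctions.Sqrt
import Mathlib.Analysis.SpecialFunctions.Pow.Deriv
import Mathlib.Analysis.Calculus.ContDiff.Deriv
import HarnessLib

/-!
# Seregin 2020, proof of Thm. 2.1: the truncated convex powers of the Moser iteration for `σ = ϱv_φ`

Analysis/FluidPDE proofs file (theorems only; no definitions, no named facts), on the discharge
path of the named fact `Literature.Analysis.FluidPDE.Seregin2020_axisymmetricSingularPoint_typeII`
(G. Seregin, *Local regularity of axisymmetric solutions to the Navier–Stokes equations*, Anal.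
Math. Phys. 10 (2020), Paper No. 46 = arXiv:2006.04140, Thm. 2.1).

The `L_∞` bound (2.6) `sup_{Q(1/2)} |σ| ≤ c(M)` of the printed proof is a Moser iteration for the
swirl equation (2.2), in which the powers `|σ|^{2m}` are tested after a truncation at height `N`
("Given `N > 0`, set `σ_N = σ` if `|σ| ≤ N`, `σ_N = N` if `σ > N`, `σ_N = -N` if `σ < -N` …
multiply the equation by `σ_N^{2m-1} ψ⁴ φ²`", arXiv p. 4; the truncation makes every integral
finite and lets the cut-off `φ` of the axis be removed, p. 5, before "`N → ∞`", p. 6). This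
file supplies, for the tree's form of that energy argument (the convex-function form of
Lei–Zhang 2011, §2, used in `LeiZhang2011EnergyEstimate`: test with `H'(σ)ζ` for a convex
`H ∈ C²` with `H'² ≤ κ H H''` and a square root `s`, `2s'² ≤ H''`), a SMOOTH replacement of the
truncated powers with all the structural inequalities built in:

* `Seregin2020.exists_moserProfile` — for real `m ≥ 1` and `N ≥ 1` there are `s, H ∈ C²(ℝ)` and
  `L ≥ 0` with `H = s²`, `s ≥ 0`, `s(0) = 0`, `H'' ≥ 0`, `2 s'² ≤ H''`, `H'² ≤ 2 H H''`,
  `s(τ) ≤ (1 + τ²)^{m/2} - 1`, `H(τ) ≤ L τ²` (quadratic growth: the truncation), and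
  `s(τ) = (1 + τ²)^{m/2} - 1` whenever `√(1 + τ²) ≤ N` (exactness below the truncation level).

Construction: `s = s̃ ∘ f` with `f(τ) = √(1 + τ²)` (smooth, convex, `≥ 1`) and `s̃` the convex
`C²` function on `[1, ∞)` with `s̃(1) = 0`, `s̃'(1) = m`,
`s̃''(y) = m(m-1) y^{m-2} (1 - smoothTransition (y - N))` (so `s̃(y) = y^m - 1` on `[1, N]`,
`s̃'' ≤ (y^m - 1)''`, `s̃'' = 0` beyond `N + 1`, `s̃' ≤ m (N+1)^{m-1}`); then `H = s²` has
`H'' - 2s'² = 2 s s'' ≥ 0` and `2HH'' - H'² = 4 s³ s'' ≥ 0` identically. Composing with `f ≥ 1`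
instead of `|σ|` removes every smoothness issue at `σ = 0`, and `‖f(σ)‖_{L^p}` controls and is
controlled by `‖σ‖_{L^p}` on bounded sets, which is all the iteration (2.5) uses.

## References

* G. Seregin, Anal. Math. Phys. 10 (2020), Paper 46 = arXiv:2006.04140, proof of Thm. 2.1,
  pp. 4–6 (truncation `σ_N`, the energy inequality, `N → ∞`). [`Seregin2020`]
* Z. Lei, Q. S. Zhang, J. Funct. Anal. 261 (2011) 2323–2345 = arXiv:1011.5066, §2 (2.2)–(2.4)
  (the convex-function form of the energy inequality for the swirl equation). [`LeiZhang2011`]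
-/

noncomputable section

open MeasureTheory Set Filter Topology intervalIntegral
open scoped ContDiff

namespace Literature.Analysis.FluidPDE

namespace Seregin2020

/-! ### The second derivative `w = s̃''` and its primitive `W = s̃' - m` -/

/-- **The density `w(ρ) = m(m-1) ρ^{m-2} (1 - smoothTransition(ρ - N))`**: smooth on `]0, ∞[`,
nonnegative there, at most `m(m-1)ρ^{m-2}`, equal to it for `ρ ≤ N` and to `0` for `ρ ≥ N + 1`.
[folklore] -/
theorem moserProfile_w_props {m N : ℝ} (hm : 1 ≤ m) {w : ℝ → ℝ}
    (hw : ∀ ρ, w ρ = m * (m - 1) * ρ ^ (m - 2) * (1 - Real.smoothTransition (ρ - N))) :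
    ContDiffOn ℝ ∞ w (Ioi 0) ∧ (∀ ρ, 0 < ρ → 0 ≤ w ρ) ∧
      (∀ ρ, 0 < ρ → w ρ ≤ m * (m - 1) * ρ ^ (m - 2)) ∧
      (∀ ρ, ρ ≤ N → w ρ = m * (m - 1) * ρ ^ (m - 2)) ∧ (∀ ρ, N + 1 ≤ ρ → w ρ = 0) := by
  have hfun : w = fun ρ => m * (m - 1) * ρ ^ (m - 2) * (1 - Real.smoothTransition (ρ - N)) :=
    funext hw
  have hm0 : 0 ≤ m * (m - 1) := mul_nonneg (by linarith) (by linarith)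
  refine ⟨?_, ?_, ?_, ?_, ?_⟩
  · intro ρ hρ
    rw [hfun]
    refine ((contDiffAt_const.mul (Real.contDiffAt_rpow_const_of_ne (ne_of_gt hρ))).mul
      (contDiffAt_const.sub ?_)).contDiffWithinAt
    exact (Real.smoothTransition.contDiff.comp (contDiff_id.sub contDiff_const)).contDiffAt
  · intro ρ hρ
    rw [hw]
    exact mul_nonneg (mul_nonneg hm0 (Real.rpow_nonneg hρ.le _))
      (sub_nonneg.2 (Real.smoothTransition.le_one _))
  · intro ρ hρ
    rw [hw]
    have h1 : 1 - Real.smoothTransition (ρ - N) ≤ 1 :=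
      sub_le_self _ (Real.smoothTransition.nonneg _)
    have h2 : 0 ≤ m * (m - 1) * ρ ^ (m - 2) := mul_nonneg hm0 (Real.rpow_nonneg hρ.le _)
    calc m * (m - 1) * ρ ^ (m - 2) * (1 - Real.smoothTransition (ρ - N))
        ≤ m * (m - 1) * ρ ^ (m - 2) * 1 := mul_le_mul_of_nonneg_left h1 h2
      _ = _ := mul_one _
  · intro ρ hρ
    rw [hw, Real.smoothTransition.zero_of_nonpos (by linarith), sub_zero, mul_one]
  · intro ρ hρ
    rw [hw, Real.smoothTransition.one_of_one_le (by linarith), sub_self, mul_zero]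

/-- `∫₁ᵘ m(m-1) ρ^{m-2} dρ = m u^{m-1} - m` for `u > 0`, `m ≥ 1`. [folklore] -/
theorem integral_mul_rpow_sub_two {m : ℝ} (hm : 1 ≤ m) {u : ℝ} (hu : 0 < u) :
    ∫ ρ in (1 : ℝ)..u, m * (m - 1) * ρ ^ (m - 2) = m * u ^ (m - 1) - m := by
  rcases eq_or_lt_of_le hm with h | h
  · subst h
    simp
  · have hne : m - 2 ≠ -1 := by intro h'; linarith
    have h0 : (0 : ℝ) ∉ uIcc (1 : ℝ) u := by
      rw [mem_uIcc]
      rintro (⟨h1, _⟩ | ⟨h1, _⟩) <;> linarith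
    rw [intervalIntegral.integral_const_mul, integral_rpow (Or.inr ⟨hne, h0⟩)]
    have e1 : m - 2 + 1 = m - 1 := by ring
    rw [e1, Real.one_rpow]
    have hm1 : m - 1 ≠ 0 := by linarith
    field_simp

/-- `∫₁ʸ m u^{m-1} du = y^m - 1` for `m ≥ 1`. [folklore] -/
theorem integral_mul_rpow_sub_one {m : ℝ} (hm : 1 ≤ m) (y : ℝ) :
    ∫ u in (1 : ℝ)..y, m * u ^ (m - 1) = y ^ m - 1 := by
  have hgt : -1 < m - 1 := by linarith
  rw [intervalIntegral.integral_const_mul, integral_rpow (Or.inl hgt)]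
  have e1 : m - 1 + 1 = m := by ring
  rw [e1, Real.one_rpow]
  have hm0 : m ≠ 0 := by linarith
  field_simp

/-- **The primitive `W(u) = ∫₁ᵘ w`** of the density: differentiable on `]0, ∞[` with `W' = w`,
`C^∞` there, `0 ≤ W(u) ≤ m u^{m-1} - m` for `u ≥ 1`, `W(u) = m u^{m-1} - m` for `1 ≤ u ≤ N`,
`W` is non-decreasing on `[1, ∞)` and constant beyond `N + 1`, hence `W ≤ m (N+1)^{m-1} - m` on
`[1, ∞)` (for `N ≥ 1`). [folklore] -/
theorem moserProfile_W_props {m N : ℝ} (hm : 1 ≤ m) (hN : 1 ≤ N) {w W : ℝ → ℝ}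
    (hw : ∀ ρ, w ρ = m * (m - 1) * ρ ^ (m - 2) * (1 - Real.smoothTransition (ρ - N)))
    (hW : ∀ u, W u = ∫ ρ in (1 : ℝ)..u, w ρ) :
    (∀ u, 0 < u → HasDerivAt W (w u) u) ∧ ContDiffOn ℝ ∞ W (Ioi 0) ∧
      (∀ u, 1 ≤ u → 0 ≤ W u) ∧ (∀ u, 1 ≤ u → W u ≤ m * u ^ (m - 1) - m) ∧
      (∀ u, 1 ≤ u → u ≤ N → W u = m * u ^ (m - 1) - m) ∧
      (∀ u, 1 ≤ u → W u ≤ m * (N + 1) ^ (m - 1) - m) := by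
  obtain ⟨hwC, hw0, hwle, hweq, hwz⟩ := moserProfile_w_props (N := N) hm hw
  have hWfun : W = fun u => ∫ ρ in (1 : ℝ)..u, w ρ := funext hW
  have hwc : ContinuousOn w (Ioi 0) := hwC.continuousOn
  -- interval integrability on subintervals of `]0, ∞[`
  have hwi : ∀ a b : ℝ, 0 < a → 0 < b → IntervalIntegrable w volume a b := by
    intro a b ha hb
    refine (hwc.mono ?_).intervalIntegrable
    intro x hx
    rw [mem_uIcc] at hx
    rcases hx with ⟨h1, _⟩ | ⟨h1, _⟩
    · exact lt_of_lt_of_le ha h1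
    · exact lt_of_lt_of_le hb h1
  -- the derivative
  have hderiv : ∀ u, 0 < u → HasDerivAt W (w u) u := by
    intro u hu
    rw [hWfun]
    exact intervalIntegral.integral_hasDerivAt_right (hwi 1 u one_pos hu)
      (hwc.stronglyMeasurableAtFilter isOpen_Ioi _ hu) (hwc.continuousAt (Ioi_mem_nhds hu))
  have hdiff : DifferentiableOn ℝ W (Ioi 0) := fun u hu =>
    (hderiv u hu).differentiableAt.differentiableWithinAt
  have hderiv_eq : ∀ u ∈ Ioi (0 : ℝ), deriv W u = w u := fun u hu => (hderiv u hu).deriv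
  have hWC : ContDiffOn ℝ ∞ W (Ioi 0) := by
    rw [contDiffOn_infty_iff_deriv_of_isOpen isOpen_Ioi]
    exact ⟨hdiff, hwC.congr hderiv_eq⟩
  -- monotonicity of the integral in the upper limit and comparison with `m u^{m-1} - m`
  have hmono : ∀ a b, 1 ≤ a → a ≤ b → W a ≤ W b := by
    intro a b ha hab
    rw [hW, hW]
    have hb : 0 < b := by linarith
    have hsplit : ∫ ρ in (1 : ℝ)..b, w ρ = (∫ ρ in (1 : ℝ)..a, w ρ) + ∫ ρ in a..b, w ρ :=
      (intervalIntegral.integral_add_adjacent_intervals (hwi 1 a one_pos (by linarith))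
        (hwi a b (by linarith) hb)).symm
    rw [hsplit]
    have hnn : 0 ≤ ∫ ρ in a..b, w ρ :=
      intervalIntegral.integral_nonneg hab fun ρ hρ => hw0 ρ (by linarith [hρ.1])
    linarith
  have hnonneg : ∀ u, 1 ≤ u → 0 ≤ W u := by
    intro u hu
    have h := hmono 1 u le_rfl hu
    rw [hW 1, intervalIntegral.integral_same] at h
    exact h
  have hupper : ∀ u, 1 ≤ u → W u ≤ m * u ^ (m - 1) - m := by
    intro u hu
    rw [hW, ← integral_mul_rpow_sub_two hm (by linarith)]
    refine intervalIntegral.integral_mono_on hu (hwi 1 u one_pos (by linarith)) ?_ ?_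
    · refine (ContinuousOn.intervalIntegrable ?_)
      refine (continuousOn_const.mul ?_)
      refine ContinuousOn.rpow_const continuousOn_id fun x hx => Or.inl ?_
      rw [uIcc_of_le hu] at hx
      exact ne_of_gt (by linarith [hx.1])
    · intro ρ hρ
      exact hwle ρ (by linarith [hρ.1])
  have hexact : ∀ u, 1 ≤ u → u ≤ N → W u = m * u ^ (m - 1) - m := by
    intro u hu huN
    rw [hW, ← integral_mul_rpow_sub_two hm (by linarith)]
    refine intervalIntegral.integral_congr fun ρ hρ => ?_
    rw [uIcc_of_le hu] at hρ
    exact hweq ρ (hρ.2.trans huN)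
  have hbound : ∀ u, 1 ≤ u → W u ≤ m * (N + 1) ^ (m - 1) - m := by
    intro u hu
    rcases le_or_gt u (N + 1) with h | h
    · exact (hmono u (N + 1) hu h).trans (hupper (N + 1) (by linarith))
    · -- beyond `N + 1` the integrand vanishes
      have hsplit : W u = W (N + 1) := by
        rw [hW, hW]
        have hadj : ∫ ρ in (1 : ℝ)..u, w ρ = (∫ ρ in (1 : ℝ)..(N + 1), w ρ) + ∫ ρ in (N + 1)..u, w ρ :=
          (intervalIntegral.integral_add_adjacent_intervals (hwi 1 (N + 1) one_pos (by linarith))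
            (hwi (N + 1) u (by linarith) (by linarith))).symm
        rw [hadj]
        have hz : ∫ ρ in (N + 1)..u, w ρ = 0 := by
          rw [intervalIntegral.integral_congr (g := fun _ => (0 : ℝ)) fun ρ hρ => ?_]
          · simp
          · rw [uIcc_of_le h.le] at hρ
            exact hwz ρ hρ.1
        rw [hz, add_zero]
      rw [hsplit]
      exact hupper (N + 1) (by linarith)
  exact ⟨hderiv, hWC, hnonneg, hupper, hexact, hbound⟩

/-! ### The convex profile `s̃` on `[1, ∞)` -/

/-- **The profile `s̃(y) = ∫₁ʸ (m + W(u)) du`**: `C^∞` on `]0, ∞[` with `s̃' = m + W`,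
`s̃'' = w ≥ 0`; for `y ≥ 1`: `0 ≤ s̃(y) ≤ y^m - 1`, `s̃(y) ≤ m(N+1)^{m-1} (y - 1)`, and
`s̃(y) = y^m - 1` for `1 ≤ y ≤ N`; `s̃(1) = 0`. [folklore] -/
theorem moserProfile_stilde_props {m N : ℝ} (hm : 1 ≤ m) (hN : 1 ≤ N) {w W st : ℝ → ℝ}
    (hw : ∀ ρ, w ρ = m * (m - 1) * ρ ^ (m - 2) * (1 - Real.smoothTransition (ρ - N)))
    (hW : ∀ u, W u = ∫ ρ in (1 : ℝ)..u, w ρ) (hst : ∀ y, st y = ∫ u in (1 : ℝ)..y, (m + W u)) :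
    (∀ y, 0 < y → HasDerivAt st (m + W y) y) ∧ (∀ y, 0 < y → HasDerivAt (fun u => m + W u) (w y) y) ∧
      ContDiffOn ℝ ∞ st (Ioi 0) ∧ st 1 = 0 ∧
      (∀ y, 1 ≤ y → 0 ≤ st y) ∧ (∀ y, 1 ≤ y → st y ≤ y ^ m - 1) ∧
      (∀ y, 1 ≤ y → st y ≤ m * (N + 1) ^ (m - 1) * (y - 1)) ∧
      (∀ y, 1 ≤ y → y ≤ N → st y = y ^ m - 1) ∧
      (∀ y, 1 ≤ y → m ≤ m + W y) ∧ (∀ y, 0 < y → 0 ≤ w y) := by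
  obtain ⟨hWd, hWC, hW0, hWle, hWeq, hWbd⟩ := moserProfile_W_props hm hN hw hW
  obtain ⟨_, hw0, _, _, _⟩ := moserProfile_w_props (N := N) hm hw
  have hstfun : st = fun y => ∫ u in (1 : ℝ)..y, (m + W u) := funext hst
  have hgC : ContDiffOn ℝ ∞ (fun u => m + W u) (Ioi 0) := contDiffOn_const.add hWC
  have hgc : ContinuousOn (fun u => m + W u) (Ioi 0) := hgC.continuousOn
  have hgi : ∀ a b : ℝ, 0 < a → 0 < b → IntervalIntegrable (fun u => m + W u) volume a b := by
    intro a b ha hb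
    refine (hgc.mono ?_).intervalIntegrable
    intro x hx
    rw [mem_uIcc] at hx
    rcases hx with ⟨h1, _⟩ | ⟨h1, _⟩
    · exact lt_of_lt_of_le ha h1
    · exact lt_of_lt_of_le hb h1
  have hderiv : ∀ y, 0 < y → HasDerivAt st (m + W y) y := by
    intro y hy
    rw [hstfun]
    exact intervalIntegral.integral_hasDerivAt_right (hgi 1 y one_pos hy)
      (hgc.stronglyMeasurableAtFilter isOpen_Ioi _ hy) (hgc.continuousAt (Ioi_mem_nhds hy))
  have hderiv2 : ∀ y, 0 < y → HasDerivAt (fun u => m + W u) (w y) y := fun y hy => by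
    simpa using (hWd y hy).const_add m
  have hstC : ContDiffOn ℝ ∞ st (Ioi 0) := by
    rw [contDiffOn_infty_iff_deriv_of_isOpen isOpen_Ioi]
    refine ⟨fun y hy => (hderiv y hy).differentiableAt.differentiableWithinAt, ?_⟩
    exact hgC.congr fun y hy => (hderiv y hy).deriv
  have hst1 : st 1 = 0 := by rw [hst, intervalIntegral.integral_same]
  -- comparison of the integrands on `[1, y]`
  have hcont_pow : ∀ y, 1 ≤ y → IntervalIntegrable (fun u : ℝ => m * u ^ (m - 1)) volume 1 y := by
    intro y hy
    refine (ContinuousOn.intervalIntegrable ?_)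
    refine continuousOn_const.mul (ContinuousOn.rpow_const continuousOn_id fun x hx => Or.inl ?_)
    rw [uIcc_of_le hy] at hx
    exact ne_of_gt (by linarith [hx.1])
  have hnonneg : ∀ y, 1 ≤ y → 0 ≤ st y := by
    intro y hy
    rw [hst]
    exact intervalIntegral.integral_nonneg hy fun u hu => by
      have := hW0 u hu.1
      linarith
  have hupper : ∀ y, 1 ≤ y → st y ≤ y ^ m - 1 := by
    intro y hy
    rw [hst, ← integral_mul_rpow_sub_one hm y]
    refine intervalIntegral.integral_mono_on hy (hgi 1 y one_pos (by linarith)) (hcont_pow y hy) ?_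
    intro u hu
    have := hWle u hu.1
    linarith
  have hlin : ∀ y, 1 ≤ y → st y ≤ m * (N + 1) ^ (m - 1) * (y - 1) := by
    intro y hy
    rw [hst]
    have h1 : ∫ u in (1 : ℝ)..y, (m + W u) ≤ ∫ _ in (1 : ℝ)..y, m * (N + 1) ^ (m - 1) := by
      refine intervalIntegral.integral_mono_on hy (hgi 1 y one_pos (by linarith))
        intervalIntegrable_const ?_
      intro u hu
      have := hWbd u hu.1
      linarith
    rw [intervalIntegral.integral_const, smul_eq_mul] at h1
    linarith
  have hexact : ∀ y, 1 ≤ y → y ≤ N → st y = y ^ m - 1 := by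
    intro y hy hyN
    rw [hst, ← integral_mul_rpow_sub_one hm y]
    refine intervalIntegral.integral_congr fun u hu => ?_
    rw [uIcc_of_le hy] at hu
    have := hWeq u hu.1 (hu.2.trans hyN)
    simp only [this]
    ring
  refine ⟨hderiv, hderiv2, hstC, hst1, hnonneg, hupper, hlin, hexact, ?_, hw0⟩
  intro y hy
  have := hW0 y hy
  linarith

/-! ### The function `f(τ) = √(1 + τ²)` -/

/-- **`f(τ) = √(1 + τ²)`**: `f ≥ 1`, `f² = 1 + τ²`, `0 ≤ f - 1 ≤ |τ|` (so `(f - 1)² ≤ τ²`),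
`f` is smooth with `f' = τ/f` and `f'' = 1/f³ > 0`. [folklore] -/
theorem sqrt_one_add_sq_props :
    (∀ τ : ℝ, 1 ≤ Real.sqrt (1 + τ ^ 2)) ∧ (∀ τ : ℝ, Real.sqrt (1 + τ ^ 2) ^ 2 = 1 + τ ^ 2) ∧
      (∀ τ : ℝ, (Real.sqrt (1 + τ ^ 2) - 1) ^ 2 ≤ τ ^ 2) ∧
      ContDiff ℝ ∞ (fun τ : ℝ => Real.sqrt (1 + τ ^ 2)) ∧
      (∀ τ : ℝ, HasDerivAt (fun τ : ℝ => Real.sqrt (1 + τ ^ 2)) (τ / Real.sqrt (1 + τ ^ 2)) τ) ∧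
      (∀ τ : ℝ, HasDerivAt (fun τ : ℝ => τ / Real.sqrt (1 + τ ^ 2))
        (1 / Real.sqrt (1 + τ ^ 2) ^ 3) τ) := by
  have hpos : ∀ τ : ℝ, 0 < 1 + τ ^ 2 := fun τ => by positivity
  have hge : ∀ τ : ℝ, 1 ≤ Real.sqrt (1 + τ ^ 2) := fun τ => by
    rw [Real.le_sqrt (by norm_num) (hpos τ).le]
    nlinarith
  have hsq : ∀ τ : ℝ, Real.sqrt (1 + τ ^ 2) ^ 2 = 1 + τ ^ 2 := fun τ => Real.sq_sqrt (hpos τ).le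
  have hd1 : ∀ τ : ℝ, HasDerivAt (fun τ : ℝ => Real.sqrt (1 + τ ^ 2)) (τ / Real.sqrt (1 + τ ^ 2)) τ := by
    intro τ
    have h1 : HasDerivAt (fun τ : ℝ => 1 + τ ^ 2) (2 * τ) τ := by
      simpa using ((hasDerivAt_pow 2 τ).const_add 1)
    have h2 := h1.sqrt (hpos τ).ne'
    convert h2 using 1
    field_simp
  refine ⟨hge, hsq, ?_, ?_, hd1, ?_⟩
  · intro τ
    have h0 : 0 ≤ Real.sqrt (1 + τ ^ 2) - 1 := by linarith [hge τ]
    have h1 : Real.sqrt (1 + τ ^ 2) ≤ 1 + |τ| := by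
      rw [Real.sqrt_le_left (by positivity)]
      nlinarith [abs_nonneg τ, sq_abs τ]
    have h2 : Real.sqrt (1 + τ ^ 2) - 1 ≤ |τ| := by linarith
    calc (Real.sqrt (1 + τ ^ 2) - 1) ^ 2 ≤ |τ| ^ 2 := pow_le_pow_left₀ h0 h2 2
      _ = τ ^ 2 := sq_abs τ
  · exact (contDiff_const.add (contDiff_id.pow 2)).sqrt fun τ => (hpos τ).ne'
  · intro τ
    set f : ℝ → ℝ := fun τ => Real.sqrt (1 + τ ^ 2) with hf
    have hfp : 0 < f τ := lt_of_lt_of_le one_pos (hge τ)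
    have hf0 : f τ ≠ 0 := ne_of_gt hfp
    have h' : HasDerivAt (fun y => y / f y) ((1 * f τ - τ * (τ / f τ)) / f τ ^ 2) τ :=
      (hasDerivAt_id' τ).div (hd1 τ) hf0
    refine h'.congr_deriv ?_
    have hf2 : f τ ^ 2 = 1 + τ ^ 2 := hsq τ
    rw [div_eq_div_iff (by positivity) (by positivity)]
    have e1 : (1 * f τ - τ * (τ / f τ)) * f τ ^ 3 = (f τ ^ 2 - τ ^ 2) * f τ ^ 2 := by
      field_simp
    rw [e1, hf2]
    ring

/-! ### The profile `s = s̃ ∘ f`, `H = s²` -/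

/-- **The truncated convex powers of the Moser iteration for the swirl.** For real `m ≥ 1` and a
truncation level `N ≥ 1` there are `C²` functions `s, H : ℝ → ℝ` and a constant `L ≥ 0` such
that: `H = s²`, `s ≥ 0`, `s(0) = 0`; `H'' ≥ 0`, `2 s'² ≤ H''` and `H'² ≤ 2 H H''` (the
hypotheses of the convex-function form of the energy inequality for the swirl equation, with
`κ = 2`); `s(τ) ≤ √(1+τ²)^m - 1` (so `H ≤ (1+τ²)^m`); `H(τ) ≤ L τ²` (quadratic growth, from the
truncation); and `s(τ) = √(1+τ²)^m - 1` whenever `√(1+τ²) ≤ N`. This is the smooth replacement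
of Seregin's truncated test functions `σ_N^{2m-1}` / powers `σ_N^{2m}` (arXiv:2006.04140, p. 4),
in the variable `f(σ) = √(1 + σ²)` (module docstring).
[cite: Seregin2020, proof of Thm. 2.1, pp. 4–6 (truncation and the limit N → ∞)] -/
theorem exists_moserProfile {m : ℝ} (hm : 1 ≤ m) {N : ℝ} (hN : 1 ≤ N) :
    ∃ s H : ℝ → ℝ, ∃ L : ℝ, 0 ≤ L ∧ ContDiff ℝ 2 s ∧ ContDiff ℝ 2 H ∧
      (∀ τ, H τ = s τ ^ 2) ∧ (∀ τ, 0 ≤ s τ) ∧ s 0 = 0 ∧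
      (∀ τ, 0 ≤ deriv (deriv H) τ) ∧
      (∀ τ, 2 * deriv s τ ^ 2 ≤ deriv (deriv H) τ) ∧
      (∀ τ, deriv H τ ^ 2 ≤ 2 * H τ * deriv (deriv H) τ) ∧
      (∀ τ, s τ ≤ Real.sqrt (1 + τ ^ 2) ^ m - 1) ∧
      (∀ τ, H τ ≤ L * τ ^ 2) ∧
      (∀ τ, Real.sqrt (1 + τ ^ 2) ≤ N → s τ = Real.sqrt (1 + τ ^ 2) ^ m - 1) := by
  -- the pieces
  obtain ⟨w, hw⟩ : ∃ w : ℝ → ℝ, ∀ ρ, w ρ = m * (m - 1) * ρ ^ (m - 2) * (1 - Real.smoothTransition (ρ - N)) :=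
    ⟨_, fun _ => rfl⟩
  obtain ⟨W, hW⟩ : ∃ W : ℝ → ℝ, ∀ u, W u = ∫ ρ in (1 : ℝ)..u, w ρ := ⟨_, fun _ => rfl⟩
  obtain ⟨st, hst⟩ : ∃ st : ℝ → ℝ, ∀ y, st y = ∫ u in (1 : ℝ)..y, (m + W u) := ⟨_, fun _ => rfl⟩
  obtain ⟨hstd, hgd, hstC, hst1, hst0, hstle, hstlin, hsteq, hgm, hw0⟩ :=
    moserProfile_stilde_props hm hN hw hW hst
  obtain ⟨hf1, hfsq, hfsub, hfC, hfd, hfd2⟩ := sqrt_one_add_sq_props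
  set f : ℝ → ℝ := fun τ => Real.sqrt (1 + τ ^ 2) with hf
  have hfpos : ∀ τ, 0 < f τ := fun τ => lt_of_lt_of_le one_pos (hf1 τ)
  -- `s = s̃ ∘ f` and its first two derivatives
  set s : ℝ → ℝ := fun τ => st (f τ) with hs
  set s1 : ℝ → ℝ := fun τ => (m + W (f τ)) * (τ / f τ) with hs1
  set s2 : ℝ → ℝ := fun τ => w (f τ) * (τ / f τ) * (τ / f τ) + (m + W (f τ)) * (1 / f τ ^ 3) with hs2
  have hsd : ∀ τ, HasDerivAt s (s1 τ) τ := fun τ =>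
    (hstd (f τ) (hfpos τ)).comp τ (hfd τ)
  have hs1d : ∀ τ, HasDerivAt s1 (s2 τ) τ := by
    intro τ
    have h1 : HasDerivAt (fun τ => m + W (f τ)) (w (f τ) * (τ / f τ)) τ :=
      (hgd (f τ) (hfpos τ)).comp τ (hfd τ)
    exact h1.mul (hfd2 τ)
  have hds : deriv s = s1 := funext fun τ => (hsd τ).deriv
  have hds1 : deriv s1 = s2 := funext fun τ => (hs1d τ).deriv
  -- smoothness of `s`
  have hsC : ContDiff ℝ 2 s := by
    rw [contDiff_iff_contDiffAt]
    intro τ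
    have h1 : ContDiffAt ℝ 2 st (f τ) :=
      ((hstC.of_le (by norm_cast)).contDiffAt (Ioi_mem_nhds (hfpos τ)))
    exact h1.comp τ (hfC.of_le (by norm_cast)).contDiffAt
  -- `H = s²` and its derivatives
  set H : ℝ → ℝ := fun τ => s τ ^ 2 with hH
  set H1 : ℝ → ℝ := fun τ => 2 * s τ * s1 τ with hH1
  set H2 : ℝ → ℝ := fun τ => 2 * s1 τ ^ 2 + 2 * s τ * s2 τ with hH2
  have hHd : ∀ τ, HasDerivAt H (H1 τ) τ := by
    intro τ
    exact ((hsd τ).pow 2).congr_deriv (by norm_num [hH1])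
  have hH1d : ∀ τ, HasDerivAt H1 (H2 τ) τ := by
    intro τ
    exact (((hsd τ).const_mul 2).mul (hs1d τ)).congr_deriv (by simp only [hH2]; ring)
  have hdH : deriv H = H1 := funext fun τ => (hHd τ).deriv
  have hdH1 : deriv H1 = H2 := funext fun τ => (hH1d τ).deriv
  have hHC : ContDiff ℝ 2 H := hsC.pow 2
  -- signs
  have hs0 : ∀ τ, 0 ≤ s τ := fun τ => hst0 (f τ) (hf1 τ)
  have hs2nn : ∀ τ, 0 ≤ s2 τ := by
    intro τ
    simp only [hs2]
    have h1 : 0 ≤ w (f τ) * (τ / f τ) * (τ / f τ) := by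
      have := hw0 (f τ) (hfpos τ)
      have hsq : 0 ≤ (τ / f τ) * (τ / f τ) := mul_self_nonneg _
      nlinarith
    have h2 : 0 ≤ (m + W (f τ)) * (1 / f τ ^ 3) := by
      have hg := hgm (f τ) (hf1 τ)
      have : 0 ≤ 1 / f τ ^ 3 := by
        have := hfpos τ
        positivity
      exact mul_nonneg (by linarith) this
    exact add_nonneg h1 h2
  -- the constant of quadratic growth
  set L' : ℝ := m * (N + 1) ^ (m - 1) with hL'
  have hL'0 : 0 ≤ L' := mul_nonneg (by linarith) (Real.rpow_nonneg (by linarith) _)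
  refine ⟨s, H, L' ^ 2, sq_nonneg _, hsC, hHC, fun τ => rfl, hs0, ?_, ?_, ?_, ?_, ?_, ?_, ?_⟩
  · -- `s 0 = 0`
    simp only [hs, hf]
    simp [hst1]
  · -- `H'' ≥ 0`
    intro τ
    rw [hdH, hdH1]
    simp only [hH2]
    have := hs2nn τ
    have := hs0 τ
    nlinarith [sq_nonneg (s1 τ)]
  · -- `2 s'² ≤ H''`
    intro τ
    rw [hds, hdH, hdH1]
    simp only [hH2]
    have := hs2nn τ
    have := hs0 τ
    nlinarith
  · -- `H'² ≤ 2 H H''`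
    intro τ
    rw [hdH, hdH1]
    simp only [hH1, hH2, hH]
    have h1 := hs2nn τ
    have h2 := hs0 τ
    have h3 : 0 ≤ s τ ^ 3 * s2 τ := mul_nonneg (pow_nonneg h2 3) h1
    nlinarith [h3]
  · -- `s ≤ f^m - 1`
    intro τ
    exact hstle (f τ) (hf1 τ)
  · -- `H ≤ L'² τ²`
    intro τ
    simp only [hH]
    have h1 : s τ ≤ L' * (f τ - 1) := hstlin (f τ) (hf1 τ)
    have h2 : 0 ≤ f τ - 1 := by linarith [hf1 τ]
    have h3 : (f τ - 1) ^ 2 ≤ τ ^ 2 := hfsub τ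
    calc s τ ^ 2 ≤ (L' * (f τ - 1)) ^ 2 := pow_le_pow_left₀ (hs0 τ) h1 2
      _ = L' ^ 2 * (f τ - 1) ^ 2 := by ring
      _ ≤ L' ^ 2 * τ ^ 2 := mul_le_mul_of_nonneg_left h3 (sq_nonneg _)
  · -- exactness below the truncation level
    intro τ hτ
    exact hsteq (f τ) (hf1 τ) hτ

end Seregin2020

end Literature.Analysis.FluidPDE
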